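import Mathlib
import HarnessLib
import Summits.CriticalPhenomena.Ising3DConformalLimit.Theses.ArmDressing
import Summits.CriticalPhenomena.Ising3DConformalLimit.Theorems.ArmDressingEvenPatternDecouplingArmBoxLimits
import Summits.CriticalPhenomena.Ising3DConformalLimit.Theorems.ArmDressingEvenPatternDecouplingPatternTransferDet
import Literature.Probability.LatticeModels.CriticalFKIsingBoxCrossingLower

/-!
# `ArmDressing.EvenPatternDecoupling` — stub `stub_macroCrossingOfHyperscaling` (PROVED)
(route `ArmDressing`, crux item stmt-CriticalPhenomena-16133, line `registered`, skeleton revision 6)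

**One-arm hyperscaling at every ratio [HS] implies the RSW-type macroscopic crossing
non-degeneracy [N]** for the critical FK-Ising model on `ℤ³` (`q = 2`, `p = 1 - e^{-2β_c(3)}`, wired
boxes `Λ_L ↑ ℤ³`): for every even `n ≥ 2`, pairwise disjoint outer closed balls `B̄(c_j, r_j)` and inner
closed balls `B̄(b_j, s_j) ⊆ B(c_j, r_j)`, there is `m > 0` such that for all small mesh `δ > 0` the
infinite-volume probability that EVERY discretised inner ball `B̄(b_j, s_j)^δ` is joined by an open
path to `(B(c_j, r_j)ᶜ)^δ` is at least `m`.

Proof (the cycle-2 reduction of the [N] worker, `work/stubs/stub_macroCrossingNondegenerate.md`).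
Fix `j`; put `x₀ = ⌊b_j/δ⌋` (`latticeApprox`), `N = ⌊s_j/(4δ)⌋`, `λ_j = ⌈4(r_j + |b_j - c_j| + 1)/s_j⌉ + 3`
and `x₁ = x₀ + λ_j N e₀`. For `4δ ≤ s_j` the box `x₀ + Λ_N` discretises into `B̄(b_j, s_j)`
(`mesh_mem_closedBall_of_mem_icc_quarter`), and for `λ_j δ ≤ 1` the box `x₁ + Λ_N` into `B(c_j, r_j)ᶜ`
(`mesh_not_mem_ball_of_mem_icc_shift`); the two boxes are disjoint (`λ_j ≥ 3`). By [HS] at ratio `λ_j`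
(constants `κ_j`, `N₀,j`), for `N ≥ N₀,j`: `κ_j θ_N² ≤ ⟨σ₀σ_{λ_j N e₀}⟩_{β_c} = ⟨σ_{x₀}σ_{x₁}⟩_{β_c}`.
The tree's `Literature.Probability.LatticeModels.eventually_prod_le_rcMeasure_real_crossAll`
(Edwards–Sokal with plus = wired boundary, the vanishing critical arm, the two-box domain-Markov arm
bound `φ¹_{Λ_L}(x₀ ↔ x₁) ≤ θ_N² φ¹_{Λ_L}(x₀ + Λ_N ↔ x₁ + Λ_N)` with the wired boundary condition
maximal, `⟨σσ⟩_{β_c} > 0`, and FKG over `j`) then gives, eventually in `L`,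
`∏_j κ_j/2 ≤ φ¹_{Λ_L}(∀ j, B̄(b_j,s_j)^δ ↔ (B(c_j,r_j)ᶜ)^δ)`; the limit `L → ∞` exists by the landed
`stub_armBoxLimits`, so `m := ∏_j κ_j/2` works for every `δ > 0` with `4δ ≤ s_j`, `λ_j δ ≤ 1`,
`N₀,j + 1 ≤ s_j/(4δ)` for all `j` — a neighbourhood of `0⁺`.

References: G. Grimmett, *The Random-Cluster Model* (2006), Thm. (3.8), Lemma (4.13), Lemma (4.14)(b),
Thm. 1.16; M. Aizenman, H. Duminil-Copin, V. Sidoravicius, CMP 334 (2015), Thm. 1.2. No definitions,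
no named facts, no `sorry`; the hypothesis [HS] is the registered neighbour stub
`stub_armHyperscalingAllRatios`, taken verbatim as an implication hypothesis.
-/

set_option maxHeartbeats 1000000

namespace Summit.CriticalPhenomena.Ising3DConformalLimit.Theorems.EvenPatternDecoupling

open scoped Topology
open Filter Set Metric MeasureTheory
open Literature.Probability.LatticeModels Literature.Probability.Percolation
open Literature.Barriers.CriticalPhenomena

/-! ### Lattice geometry of the two small boxes -/

/-- The rounded-down centre: `|δ ⌊t/δ⌋ - t| ≤ δ`. [folklore] -/
private theorem abs_mul_latticeApprox_sub_le' {δ : ℝ} (hδ : 0 < δ) (z : EuclideanSpace ℝ (Fin 3))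
    (i : Fin 3) :
    |δ * ((latticeApprox δ z i : ℤ) : ℝ) - z i| ≤ δ := by
  rw [latticeApprox_apply, abs_le]
  have h1 : ((⌊z i / δ⌋ : ℤ) : ℝ) ≤ z i / δ := Int.floor_le _
  have h2 : z i / δ < ((⌊z i / δ⌋ : ℤ) : ℝ) + 1 := Int.lt_floor_add_one _
  rw [le_div_iff₀ hδ] at h1
  rw [div_lt_iff₀ hδ] at h2
  constructor <;> nlinarith

/-- **The inner box discretises into the inner ball**: for `4δ ≤ s`, every lattice point of
`⌊b/δ⌋ + Λ_{⌊s/(4δ)⌋}` has its mesh-`δ` image in `B̄(b, s)` (each coordinate is within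
`δ⌊s/(4δ)⌋ + δ ≤ s/2` of `b`). [folklore] -/
theorem mesh_mem_closedBall_of_mem_icc_quarter {δ s : ℝ} (hδ : 0 < δ) (hδs : 4 * δ ≤ s)
    (b : EuclideanSpace ℝ (Fin 3)) {y : Site 3}
    (hy : y ∈ Finset.Icc (fun i => -(⌊s / (4 * δ)⌋₊ : ℤ) + latticeApprox δ b i)
      (fun i => (⌊s / (4 * δ)⌋₊ : ℤ) + latticeApprox δ b i)) :
    (WithLp.toLp 2 fun i : Fin 3 => δ * (y i : ℝ) : EuclideanSpace ℝ (Fin 3)) ∈ closedBall b s := by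
  have hs0 : 0 ≤ s / (4 * δ) := div_nonneg (by linarith) (by linarith)
  have hN : (⌊s / (4 * δ)⌋₊ : ℝ) ≤ s / (4 * δ) := Nat.floor_le hs0
  have hNδ : δ * (⌊s / (4 * δ)⌋₊ : ℝ) ≤ s / 4 := by
    have e : δ * (s / (4 * δ)) = s / 4 := by field_simp
    have h := mul_le_mul_of_nonneg_left hN hδ.le
    linarith
  rw [mem_closedBall]
  have key : ∀ i : Fin 3, dist ((WithLp.toLp 2 fun i : Fin 3 => δ * (y i : ℝ) :
      EuclideanSpace ℝ (Fin 3)) i) (b i) ≤ s / 2 := by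
    intro i
    rw [PiLp.toLp_apply, Real.dist_eq]
    have h1 := (mem_siteIcc_iff.1 hy i)
    have h1a : -(⌊s / (4 * δ)⌋₊ : ℝ) + (latticeApprox δ b i : ℝ) ≤ (y i : ℝ) := by exact_mod_cast h1.1
    have h1b : (y i : ℝ) ≤ (⌊s / (4 * δ)⌋₊ : ℝ) + (latticeApprox δ b i : ℝ) := by exact_mod_cast h1.2
    have h2 := abs_le.1 (abs_mul_latticeApprox_sub_le' hδ b i)
    rw [abs_le]
    constructor <;> nlinarith
  have h := dist_euclidean_le_two_mul (by linarith : (0 : ℝ) ≤ s / 2) key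
  linarith

/-- **The outer box discretises into the outer complement**: with `x₀ = ⌊b/δ⌋`, `N = ⌊s/(4δ)⌋`,
`r + |b - c| + 1 ≤ (λ - 1) s/4` and `λδ ≤ 1`, every lattice point of `x₀ + λN e₀ + Λ_N` has
its mesh-`δ` image outside `B(c, r)` (its first coordinate is at least `(λ-1)(s/4 - δ) - δ ≥ r + |b-c|`
away from `b`). [folklore] -/
theorem mesh_not_mem_ball_of_mem_icc_shift {δ s r : ℝ} (hδ : 0 < δ)
    (b c : EuclideanSpace ℝ (Fin 3)) {lam : ℕ} (hlam : 1 ≤ lam)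
    (hgeom : r + dist b c + 1 ≤ ((lam : ℝ) - 1) * s / 4) (hlamδ : (lam : ℝ) * δ ≤ 1) {w : Site 3}
    (hw : w ∈ Finset.Icc
      (fun i => -(⌊s / (4 * δ)⌋₊ : ℤ) +
        (latticeApprox δ b + Pi.single 0 ((lam * ⌊s / (4 * δ)⌋₊ : ℕ) : ℤ) : Site 3) i)
      (fun i => (⌊s / (4 * δ)⌋₊ : ℤ) +
        (latticeApprox δ b + Pi.single 0 ((lam * ⌊s / (4 * δ)⌋₊ : ℕ) : ℤ) : Site 3) i)) :
    (WithLp.toLp 2 fun i : Fin 3 => δ * (w i : ℝ) : EuclideanSpace ℝ (Fin 3)) ∉ ball c r := by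
  set N := ⌊s / (4 * δ)⌋₊ with hN
  have hNlt : s / (4 * δ) < (N : ℝ) + 1 := Nat.lt_floor_add_one _
  have hNδ : s / 4 - δ ≤ δ * (N : ℝ) := by
    rw [div_lt_iff₀ (by linarith : (0 : ℝ) < 4 * δ)] at hNlt
    nlinarith
  have hw0 := (mem_siteIcc_iff.1 hw 0).1
  rw [Pi.add_apply, Pi.single_eq_same] at hw0
  push_cast at hw0
  have hw0' : -(N : ℝ) + ((latticeApprox δ b 0 : ℝ) + (lam : ℝ) * N) ≤ (w 0 : ℝ) := by exact_mod_cast hw0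
  have h2 := abs_le.1 (abs_mul_latticeApprox_sub_le' hδ b 0)
  have hlam1 : (0 : ℝ) ≤ (lam : ℝ) - 1 := by
    have : (1 : ℝ) ≤ lam := by exact_mod_cast hlam
    linarith
  -- the first coordinate of the mesh image is far to the right of `b 0`
  have hfar : r + dist b c ≤ δ * (w 0 : ℝ) - b 0 := by
    have e1 : ((lam : ℝ) - 1) * (s / 4 - δ) ≤ ((lam : ℝ) - 1) * (δ * N) :=
      mul_le_mul_of_nonneg_left hNδ hlam1
    nlinarith
  intro hmem
  rw [mem_ball] at hmem
  have hcoord : dist ((WithLp.toLp 2 fun i : Fin 3 => δ * (w i : ℝ) : EuclideanSpace ℝ (Fin 3)) 0) (b 0) ≤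
      dist (WithLp.toLp 2 fun i : Fin 3 => δ * (w i : ℝ) : EuclideanSpace ℝ (Fin 3)) b :=
    PiLp.dist_apply_le _ _ 0
  rw [PiLp.toLp_apply, Real.dist_eq] at hcoord
  have habs : δ * (w 0 : ℝ) - b 0 ≤ |δ * (w 0 : ℝ) - b 0| := le_abs_self _
  have htri := dist_triangle (WithLp.toLp 2 fun i : Fin 3 => δ * (w i : ℝ) : EuclideanSpace ℝ (Fin 3)) c b
  rw [dist_comm c b] at htri
  linarith

/-- The ratio constant makes room for the outer box: with `λ = ⌈4(r + D + 1)/s⌉ + 3` and `s > 0`,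
`r + D + 1 ≤ (λ - 1) s / 4` (also when `r + D + 1 < 0`). [folklore] -/
theorem geom_of_lam {s r D : ℝ} (hs : 0 < s) :
    r + D + 1 ≤ (((⌈4 * (r + D + 1) / s⌉₊ + 3 : ℕ) : ℝ) - 1) * s / 4 := by
  have h1 : 4 * (r + D + 1) / s ≤ (⌈4 * (r + D + 1) / s⌉₊ : ℝ) := Nat.le_ceil _
  rw [div_le_iff₀ hs] at h1
  push_cast
  nlinarith

/-- Disjointness of the two small boxes: `2N < λN` for `λ ≥ 3`, `N ≥ 1`. [folklore] -/
theorem two_mul_lt_cast_mul {lam N : ℕ} (hlam : 3 ≤ lam) (hN : 1 ≤ N) :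
    2 * (N : ℤ) < ((lam * N : ℕ) : ℤ) := by
  have h : 3 * N ≤ lam * N := Nat.mul_le_mul_right N hlam
  push_cast
  have h' : (3 : ℤ) * N ≤ (lam : ℤ) * N := by exact_mod_cast h
  omega

/-! ### The lower bound for one admissible mesh -/

/-- **For an admissible mesh `δ` the limit crossing probability is at least `∏_j κ_j/2`**: given the
data of the stub, ratio constants `λ_j ≥ 3` with `r_j + |b_j - c_j| + 1 ≤ (λ_j - 1)s_j/4`, and
hyperscaling constants `κ_j > 0`, `N₀,j` at ratio `λ_j`, every `δ > 0` with `4δ ≤ s_j`, `λ_j δ ≤ 1`,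
`N₀,j + 1 ≤ s_j/(4δ)` satisfies `∏_j κ_j/2 ≤ lim_L φ¹_{Λ_L}(∀ j, B̄(b_j,s_j)^δ ↔ (B(c_j,r_j)ᶜ)^δ)`
(`eventually_prod_le_rcMeasure_real_crossAll` for the finite-volume bound, `stub_armBoxLimits` for
the existence of the limit). [cite: Grimmett2006, Thm. (3.8) and Lemma (4.14)(b)] -/
theorem prod_le_limUnder_crossAll {n : ℕ} (c : Fin n → EuclideanSpace ℝ (Fin 3)) (r : Fin n → ℝ)
    (b : Fin n → EuclideanSpace ℝ (Fin 3)) (s : Fin n → ℝ) (lam N₀ : Fin n → ℕ) (κ : Fin n → ℝ)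
    (hlam : ∀ j, 3 ≤ lam j) (hκ : ∀ j, 0 < κ j)
    (hHS : ∀ j N, N₀ j ≤ N → κ j * thetaWiredBox 3 (fkIsingParam (criticalBeta 3)) 2 N ^ 2 ≤
      criticalTwoPoint 3 (Pi.single 0 ((lam j * N : ℕ) : ℤ)))
    (hgeom : ∀ j, r j + dist (b j) (c j) + 1 ≤ ((lam j : ℝ) - 1) * s j / 4)
    {δ : ℝ} (hδ : 0 < δ) (hδs : ∀ j, 4 * δ ≤ s j) (hδlam : ∀ j, (lam j : ℝ) * δ ≤ 1)
    (hδN : ∀ j, (N₀ j : ℝ) + 1 ≤ s j / (4 * δ)) :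
    ∏ j, κ j / 2 ≤ limUnder atTop (fun L : ℕ =>
      (rcMeasure (boxGraph 3 L) (fkIsingParam (criticalBeta 3)) 2 (boxBoundary 3 L)).real
        {ω | (fun i j => ∃ x y : BoxV 3 L,
            x.1 ∈ Fin.append
              (fun j => {x : Site 3 | (WithLp.toLp 2 fun i : Fin 3 => δ * (x i : ℝ) :
                EuclideanSpace ℝ (Fin 3)) ∈ closedBall (b j) (s j)})
              (fun j => {x : Site 3 | (WithLp.toLp 2 fun i : Fin 3 => δ * (x i : ℝ) :
                EuclideanSpace ℝ (Fin 3)) ∈ (ball (c j) (r j))ᶜ}) i ∧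
            y.1 ∈ Fin.append
              (fun j => {x : Site 3 | (WithLp.toLp 2 fun i : Fin 3 => δ * (x i : ℝ) :
                EuclideanSpace ℝ (Fin 3)) ∈ closedBall (b j) (s j)})
              (fun j => {x : Site 3 | (WithLp.toLp 2 fun i : Fin 3 => δ * (x i : ℝ) :
                EuclideanSpace ℝ (Fin 3)) ∈ (ball (c j) (r j))ᶜ}) j ∧
            (openGraph ω).Reachable x y) ∈
          {R : Fin (n + n) → Fin (n + n) → Prop | ∀ i : Fin n, R (Fin.castAdd n i) (Fin.natAdd n i)}}) := by
  -- the two families of small boxes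
  set N : Fin n → ℕ := fun j => ⌊s j / (4 * δ)⌋₊ with hNdef
  set x₀ : Fin n → Site 3 := fun j => latticeApprox δ (b j) with hx₀
  set x₁ : Fin n → Site 3 := fun j => x₀ j + Pi.single 0 ((lam j * N j : ℕ) : ℤ) with hx₁
  have hN₀ : ∀ j, N₀ j + 1 ≤ N j := fun j =>
    Nat.le_floor (by push_cast; exact hδN j)
  have hHS' : ∀ j, κ j * thetaWiredBox 3 (fkIsingParam (criticalBeta 3)) 2 (N j) ^ 2 ≤
      criticalTwoPoint 3 (x₁ j - x₀ j) := by
    intro j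
    rw [hx₁]
    simp only [add_sub_cancel_left]
    exact hHS j (N j) (by have := hN₀ j; omega)
  have hdisj : ∀ j, Disjoint
      (Finset.Icc (fun i => -(N j : ℤ) + x₀ j i) (fun i => (N j : ℤ) + x₀ j i))
      (Finset.Icc (fun i => -(N j : ℤ) + x₁ j i) (fun i => (N j : ℤ) + x₁ j i)) := fun j =>
    disjoint_icc_shift_add_single (x₀ j) 0 (two_mul_lt_cast_mul (hlam j) (by have := hN₀ j; omega))
  -- the finite-volume bound, eventually in `L`
  have hev := eventually_prod_le_rcMeasure_real_crossAll (d := 3) le_rfl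
    (Fin.append
      (fun j => {x : Site 3 | (WithLp.toLp 2 fun i : Fin 3 => δ * (x i : ℝ) :
        EuclideanSpace ℝ (Fin 3)) ∈ closedBall (b j) (s j)})
      (fun j => {x : Site 3 | (WithLp.toLp 2 fun i : Fin 3 => δ * (x i : ℝ) :
        EuclideanSpace ℝ (Fin 3)) ∈ (ball (c j) (r j))ᶜ}))
    x₀ x₁ N κ (fun j => (hκ j).le) hdisj hHS' (fun j y hy => ?_) (fun j y hy => ?_)
  rotate_left
  · simp only [Fin.append_left, Set.mem_setOf_eq]
    exact mesh_mem_closedBall_of_mem_icc_quarter hδ (hδs j) (b j) (Finset.mem_coe.1 hy)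
  · simp only [Fin.append_right, Set.mem_setOf_eq, Set.mem_compl_iff]
    exact mesh_not_mem_ball_of_mem_icc_shift hδ (b j) (c j) (by have := hlam j; omega) (hgeom j)
      (hδlam j) (Finset.mem_coe.1 hy)
  -- the limit exists (landed stub `stub_armBoxLimits`)
  have hlim := stub_armBoxLimits
  dsimp only at hlim
  obtain ⟨a, -, hT⟩ := (hlim n c r b s b δ hδ (fun j => by linarith [hδs j])).2
  calc ∏ j, κ j / 2 ≤ a := ge_of_tendsto hT hev
    _ = _ := hT.limUnder_eq.symm

/-! ### Neighbourhoods of `0⁺` -/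

/-- For `t > 0`, eventually as `δ → 0⁺` we have `δ ≤ t`. [folklore] -/
theorem eventually_nhdsGT_le {t : ℝ} (ht : 0 < t) : ∀ᶠ δ in 𝓝[>] (0 : ℝ), δ ≤ t :=
  (nhdsWithin_le_nhds (Iic_mem_nhds ht) : Set.Iic t ∈ 𝓝[>] (0 : ℝ))

/-! ### The stub -/

-- the registered stub signature is the crux's full `let` preamble, most of which is not used by
-- this clause (linter.unusedVariables would flag the verbatim statement)
set_option linter.unusedVariables false in
/-- stub NofHS of the skeleton of crux `EvenPatternDecoupling` (line `registered`, revision 6), PROVED: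
**one-arm hyperscaling at every ratio [HS] implies the RSW-type macroscopic crossing non-degeneracy
[N]** — if `κ_λ φ¹_{Λ_N}(0 ↔ ∂Λ_N)² ≤ ⟨σ₀σ_{λN e₀}⟩_{β_c}` for all large `N`, every `λ ≥ 1`, then for
every even `n ≥ 2`, disjoint outer balls and inner balls `B̄(b_j,s_j) ⊆ B(c_j,r_j)` there is `m > 0`
with `m ≤ Pr[∀ j, B̄(b_j,s_j)^δ ↔ (B(c_j,r_j)ᶜ)^δ]` for all small `δ > 0`. With
`λ_j = ⌈4(r_j + |b_j-c_j| + 1)/s_j⌉ + 3` and `(κ_j, N₀,j)` from [HS], `m = ∏_j κ_j/2`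
(`prod_le_limUnder_crossAll`: domain Markov with the wired boundary condition maximal around the two
small boxes `⌊b_j/δ⌋ + Λ_N`, `⌊b_j/δ⌋ + λ_j N e₀ + Λ_N`, `N = ⌊s_j/(4δ)⌋`, Edwards–Sokal, the vanishing
critical arm, FKG, and the limit `stub_armBoxLimits`), valid once `4δ ≤ s_j`, `λ_j δ ≤ 1`,
`N₀,j + 1 ≤ s_j/(4δ)` for all `j`. [cite: Grimmett2006, Thm. (3.8), Lemma (4.13) and Lemma (4.14)(b)] -/
theorem stub_macroCrossingOfHyperscaling : open Literature.Probability.LatticeModels Literature.Probability.Percolation Literature.Barriers.CriticalPhenomena Filter Topology in let E3:=EuclideanSpace ℝ (Fin 3); let μ : (L : ℕ)→MeasureTheory.Measure (BondConfig (BoxV 3 L)):=fun L=>rcMeasure (boxGraph 3 L) (fkIsingParam (criticalBeta 3)) 2 (boxBoundary 3 L); let PrL : (m : ℕ)→(Fin m→Set (Site 3))→Set (Fin m→Fin m→Prop)→ℕ→ℝ:=fun _ K R L=>(μ L).real {ω | (fun i j=>∃ x y : BoxV 3 L, x.1∈K i∧y.1∈K j∧(openGraph ω).Reachable x y)∈R};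 let Pr : (m : ℕ)→(Fin m→Set (Site 3))→Set (Fin m→Fin m→Prop)→ℝ:=fun m K R=>limUnder atTop (PrL m K R); let mesh : ℝ→Site 3→E3:=fun δ z=>WithLp.toLp 2 fun i : Fin 3=>δ * (z i : ℝ); let disc : ℝ→Set E3→Set (Site 3):=fun δ A=>{x | mesh δ x∈A}; let EVEN : (n : ℕ)→Set (Fin n→Fin n→Prop):=fun n=>{R | ∀ i, Even ({j : Fin n | R i j}.ncard)}; let EVEN2 : (n : ℕ)→Set (Fin (n + n)→Fin (n + n)→Prop):=fun n=>{R | ∀ i : Fin n, Even ({j : Fin n | R (Fin.castAdd n i) (Fin.castAdd n j)}.ncard)}; let CROSS : (n : ℕ)→Set (Fin (n + n)→Fin (n + n)→Prop):=fun n=>{R | ∀ i : Fin n, R (Fin.castAdd n i) (Fin.natAdd n i)}; let pts : (n : ℕ)→ℝ→(Fin n→E3)→(Fin n→Set (Site 3)):=fun _ δ z j=>{latticeApprox δ (z j)}; let fam : (n : ℕ)→ℝ→(Fin n→Set E3)→(Fin n→Set E3)→(Fin (n + n)→Set (Site 3)):=fun _ δ A B=>Fin.append (fun j=>disc δ (A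 j)) (fun j=>disc δ (B j)); (∀ lam : ℕ, 1≤lam→∃ κ : ℝ, 0 < κ∧∃ N₀ : ℕ, ∀ N : ℕ, N₀≤N→κ * (thetaWiredBox 3 (fkIsingParam (criticalBeta 3)) 2 N) ^ 2≤criticalTwoPoint 3 (Pi.single 0 ((lam * N : ℕ) : ℤ)))→∀ (n : ℕ), 2≤n→Even n→∀ (c : Fin n→E3) (r : Fin n→ℝ), (∀ j, 0 < r j)→(∀ j k, j ≠ k→Disjoint (Metric.closedBall (c j) (r j)) (Metric.closedBall (c k) (r k)))→∀ (b : Fin n→E3) (s : Fin n→ℝ), (∀ j, 0 < s j)→(∀ j, Metric.closedBall (b j) (s j)⊆Metric.ball (c j) (r j))→∃ m : ℝ, 0 < m∧∀ᶠ δ in 𝓝[>] 0, m≤Pr (n + n) (fam n δ (fun j=>Metric.closedBall (b j) (s j)) (fun j=>(Metric.ball (c j) (r j))ᶜ)) (CROSS n) := by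
  dsimp only
  intro hHS n hn he c r hr hd b s hs hbs
  -- constants: ratios, hyperscaling constants, and the bound `m`
  set lam : Fin n → ℕ := fun j => ⌈4 * (r j + dist (b j) (c j) + 1) / s j⌉₊ + 3 with hlam
  have hlam3 : ∀ j, 3 ≤ lam j := fun j => Nat.le_add_left 3 _
  have hgeom : ∀ j, r j + dist (b j) (c j) + 1 ≤ ((lam j : ℝ) - 1) * s j / 4 := fun j =>
    geom_of_lam (hs j)
  choose κ hκ N₀ hN₀ using fun j => hHS (lam j) (by have := hlam3 j; omega)
  refine ⟨∏ j, κ j / 2, Finset.prod_pos fun j _ => by linarith [hκ j], ?_⟩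
  -- the admissible meshes form a neighbourhood of `0⁺`
  have h0 : ∀ᶠ δ in 𝓝[>] (0 : ℝ), 0 < δ := self_mem_nhdsWithin
  have h1 : ∀ᶠ δ in 𝓝[>] (0 : ℝ), ∀ j, 4 * δ ≤ s j := by
    refine Filter.eventually_all.2 fun j => ?_
    filter_upwards [eventually_nhdsGT_le (by linarith [hs j] : 0 < s j / 4)] with δ hδ
    linarith
  have h2 : ∀ᶠ δ in 𝓝[>] (0 : ℝ), ∀ j, (lam j : ℝ) * δ ≤ 1 := by
    refine Filter.eventually_all.2 fun j => ?_
    have hl : (0 : ℝ) < lam j := by have := hlam3 j; positivity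
    filter_upwards [eventually_nhdsGT_le (one_div_pos.2 hl)] with δ hδ
    rw [le_div_iff₀ hl] at hδ
    linarith
  have h3 : ∀ᶠ δ in 𝓝[>] (0 : ℝ), ∀ j, (N₀ j : ℝ) + 1 ≤ s j / (4 * δ) := by
    refine Filter.eventually_all.2 fun j => ?_
    have hq : (0 : ℝ) < s j / (4 * ((N₀ j : ℝ) + 1)) := by have := hs j; positivity
    filter_upwards [h0, eventually_nhdsGT_le hq] with δ hδ0 hδ
    rw [le_div_iff₀ (by positivity), mul_comm]
    rw [le_div_iff₀ (by positivity)] at hδ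
    linarith
  filter_upwards [h0, h1, h2, h3] with δ hδ0 hδ1 hδ2 hδ3
  exact prod_le_limUnder_crossAll c r b s lam N₀ κ hlam3 hκ (fun j N hN => hN₀ j N hN) hgeom hδ0 hδ1
    hδ2 hδ3

end Summit.CriticalPhenomena.Ising3DConformalLimit.Theorems.EvenPatternDecoupling
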